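import Literature.NumberTheory.DiophantineApproximation.ViolaZudilinIntegrals
import Literature.NumberTheory.DiophantineApproximation.DilogHermitePadeArithmetic
import Mathlib.Analysis.SpecialFunctions.Integrals.Basic
import HarnessLib

/-!
# `d_A d_B ∫₀¹∫₀¹ S(x,y) dx dy ∈ ℤ` for an integer polynomial `S` with `deg_x S < A`, `deg_y S < B`

Topic `Literature/NumberTheory/DiophantineApproximation`. Everything here is PROVED (no definitions, no named
facts). This is the arithmetic core of the polynomial case in the permutation group method: G. Rhin, C. Viola,
*The permutation group method for the dilogarithm*, Ann. Sc. Norm. Super. Pisa (5) 4 (2005) 389–437,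
Lemma 2.2 (p. 395: when `j+k−m < 0` the integrand of `I_z(h,j,k,l,m)` is a polynomial `S(x,y,z) ∈ ℤ[x,y,z]`
with `deg_x S = m+h−k−1`, `deg_y S = l+m−j−1`, and "`d_{m+h−k} d_{l+m−j} z^{l+m} I_z = d_{H'} d_{K'} ∫₀¹∫₀¹ S dx dy
= T(z) ∈ ℤ[z]`"), resting on `∫₀¹ x^a dx = 1/(a+1)` and `(a+1) ∣ d_A = lcm(1,…,A)` for `a < A`.

We prove the `z`-free statement for `S(x,y) = Σ_{a<A} Σ_{b<B} c_{ab} x^a y^b`, `c_{ab} ∈ ℤ`: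
`∫∫_{[0,1]²} S = Σ c_{ab}/((a+1)(b+1))` and `d_A d_B ∫∫_{[0,1]²} S ∈ ℤ` (the `ℤ[z]` version of the paper follows
coefficientwise). The square is `ViolaZudilin.unitSquare = [0,1]²` of `ViolaZudilinIntegrals.lean`.

## References

* G. Rhin, C. Viola, Ann. Sc. Norm. Super. Pisa Cl. Sci. (5) 4 (2005) 389–437, Lemma 2.2 (proof). [RhinViola2005]
-/

noncomputable section

namespace Literature.NumberTheory.DiophantineApproximation

namespace RhinViola

open _root_.MeasureTheory _root_.Set Finset
open ViolaZudilin (unitSquare volume_restrict_unitSquare measurableSet_unitSquare isCompact_unitSquare)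

/-- `∫∫_{[0,1]²} x^a y^b dx dy = 1/((a+1)(b+1))`. [folklore] -/
theorem setIntegral_unitSquare_pow_mul_pow (a b : ℕ) :
    ∫ p in unitSquare, p.1 ^ a * p.2 ^ b = 1 / (((a : ℝ) + 1) * ((b : ℝ) + 1)) := by
  rw [show (∫ p in unitSquare, p.1 ^ a * p.2 ^ b) = ∫ p, p.1 ^ a * p.2 ^ b
      ∂((volume : Measure ℝ).restrict (Icc 0 1)).prod ((volume : Measure ℝ).restrict (Icc 0 1)) by
    rw [← volume_restrict_unitSquare]]
  rw [integral_prod_mul (fun x : ℝ => x ^ a) (fun y : ℝ => y ^ b), integral_Icc_eq_integral_Ioc,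
    ← intervalIntegral.integral_of_le zero_le_one, integral_Icc_eq_integral_Ioc,
    ← intervalIntegral.integral_of_le zero_le_one, integral_pow, integral_pow]
  simp [mul_comm]

/-- The monomials are integrable on the square. [folklore] -/
theorem integrableOn_unitSquare_pow_mul_pow (a b : ℕ) :
    IntegrableOn (fun p : ℝ × ℝ => p.1 ^ a * p.2 ^ b) unitSquare volume :=
  (by fun_prop : Continuous fun p : ℝ × ℝ => p.1 ^ a * p.2 ^ b).continuousOn.integrableOn_compact
    isCompact_unitSquare

/-- **`∫∫_{[0,1]²} Σ_{a<A,b<B} c_{ab} x^a y^b = Σ c_{ab}/((a+1)(b+1))`.**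
[cite: RhinViola2005, Lemma 2.2 (proof)] -/
theorem setIntegral_unitSquare_poly (A B : ℕ) (c : ℕ → ℕ → ℤ) :
    ∫ p in unitSquare, ∑ a ∈ range A, ∑ b ∈ range B, (c a b : ℝ) * (p.1 ^ a * p.2 ^ b) =
      ∑ a ∈ range A, ∑ b ∈ range B, (c a b : ℝ) / (((a : ℝ) + 1) * ((b : ℝ) + 1)) := by
  rw [integral_finsetSum _ fun a _ => ?_]
  · refine sum_congr rfl fun a _ => ?_
    rw [integral_finsetSum _ fun b _ => ?_]
    · refine sum_congr rfl fun b _ => ?_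
      rw [integral_const_mul, setIntegral_unitSquare_pow_mul_pow]
      ring
    · exact (integrableOn_unitSquare_pow_mul_pow a b).const_mul _
  · exact integrable_finsetSum _ fun b _ => (integrableOn_unitSquare_pow_mul_pow a b).const_mul _

/-- **Rhin–Viola's Lemma 2.2, arithmetic core: `d_A d_B ∫₀¹∫₀¹ S(x,y) dx dy ∈ ℤ`** for
`S = Σ_{a<A,b<B} c_{ab} x^a y^b` with integer coefficients (`d_N = lcm(1,…,N)`; `(a+1) ∣ d_A`, `(b+1) ∣ d_B`).
[cite: RhinViola2005, Lemma 2.2 (proof)] -/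
theorem exists_int_eq_lcm_mul_setIntegral_poly (A B : ℕ) (c : ℕ → ℕ → ℤ) :
    ∃ M : ℤ, (M : ℝ) = (Nat.lcmUpto A : ℝ) * Nat.lcmUpto B *
      ∫ p in unitSquare, ∑ a ∈ range A, ∑ b ∈ range B, (c a b : ℝ) * (p.1 ^ a * p.2 ^ b) := by
  refine ⟨∑ a ∈ range A, ∑ b ∈ range B,
    c a b * ((Nat.lcmUpto A : ℤ) / (a + 1)) * ((Nat.lcmUpto B : ℤ) / (b + 1)), ?_⟩
  rw [setIntegral_unitSquare_poly, mul_sum]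
  push_cast
  refine sum_congr rfl fun a ha => ?_
  rw [mul_sum]
  refine sum_congr rfl fun b hb => ?_
  have haA : a + 1 ≤ A := mem_range.1 ha
  have hbB : b + 1 ≤ B := mem_range.1 hb
  have hdA : ((a + 1 : ℕ) : ℤ) ∣ (Nat.lcmUpto A : ℤ) := DilogPade.natCast_dvd_lcmUpto (by omega) haA
  have hdB : ((b + 1 : ℕ) : ℤ) ∣ (Nat.lcmUpto B : ℤ) := DilogPade.natCast_dvd_lcmUpto (by omega) hbB
  have ha0 : ((a : ℝ) + 1) ≠ 0 := by positivity
  have hb0 : ((b : ℝ) + 1) ≠ 0 := by positivity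
  rw [Int.cast_div (by exact_mod_cast hdA) (by push_cast; exact ha0),
    Int.cast_div (by exact_mod_cast hdB) (by push_cast; exact hb0)]
  push_cast
  field_simp

end RhinViola

end Literature.NumberTheory.DiophantineApproximation

end
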